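import Summits.BirchSwinnertonDyer.Rank1Residual.Additive.SupersingularTwistTowerThree
import Summits.BirchSwinnertonDyer.Rank1Residual.Additive.X4SupersingularTwistRankZeroThreeClassNoMilne
import HarnessLib

/-!
# X4 ∧ good supersingular twist at `p = 3`: the tower / class corollaries over `K = ℚ(ζ₃)` (line V18) — Milne's A73 PROVED AWAY
# (cell `b2b-bsdres`, team n1011, seat p16 GEN 11; lead R5-87 (e) (W2) = additive-p4 GEN 23 word: the
# UPPER / two-sided no-Milne twins of the additive-p4 ℚ(ζ₃) lines are the p16 lineage's; row T-MIL-CAN)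

HONEST FRAMING (cell `b2b-bsdres`, run/shared/lean/b2b/bsd-rank1-residual/, verbatim in every
file): the goal of the cell is to DELETE the COMBINATION-SHAPED residual classes of the
Birch–Swinnerton-Dyer formula for ALL analytic-rank `≤ 1` elliptic curves over `ℚ` — "full BSD
formula for every rank `≤ 1` curve in class `C`" assembled STRICTLY from published theorems — so
that the rank-`≤ 1` remainder becomes exactly the CONSTRUCTION-SHAPED classes, which are TYPED
(missing-input `Prop`s), NOT attempted. This is not "finishing BSD". Team n1011 (N10 / N11), seat p16:
research route; X1 / X3 / X4 / X10 / N10 / N11 labels and marks UNCHANGED; nothing booked. Theorems only.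

This file is `SupersingularTwistTowerThree.lean` (mathematics, census and references in THAT file's docstrings,
unchanged) with the Milne binder `hMilne : Milne1972.bsdQuotient_baseChange_quadratic_anyModel` (A73)
DELETED from every Milne-binding theorem and NOTHING added: each such theorem is re-issued under its name
with the suffix `_noMilne`, every other binder and every proof line byte-identical, every call to a
Milne-binding tree theorem redirected to its no-Milne twin (`…_noLocal` cores / `…_noMilne` Facts of the
p16 lineage); Milne-free helpers of the source file are used as landed, not re-declared. What the
additive-p4 cores read from A73 — `Ш(V_K)` finite and the `3`-adic valuation of the card identity over
`K = ℚ(ζ₃)` — are the THEOREMS `shaFinite_baseChange_of_twist` and T-MIL-CAN FILE 4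
`padicVal_card_identity_baseChange[_anyRank]_of_natAbs_discr_eq` (`|d_K| = 3`, `V` good or multiplicative
at `3`: the per-place fibre identities (T) at EVERY place — n1011-p01's T-MIL-3 H-5a with rows T-MIL-B2 /
T-A233 inside). Every other displayed hypothesis (named facts, (⊇/K) where present, census bits,
certificates) is exactly the source file's. Labels UNCHANGED; nothing booked; no mark moves.
-/

noncomputable section

open scoped Classical MatrixGroups ModularForm

open CongruenceSubgroup WeierstrassCurve NumberField
  Literature.NumberTheory.EllipticCurves Literature.NumberTheory.EllipticCurves.ModularForms
  Literature.NumberTheory.EllipticCurves.Rank1Residual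
  Literature.NumberTheory.EllipticCurves.Rank1Residual.Typed
  Literature.NumberTheory.EllipticCurves.Kobayashi2003
  Literature.NumberTheory.GaloisRepresentations

namespace Summit.BirchSwinnertonDyer.Rank1Residual.Additive

/-! ### §1 The `3`-adic tower on a good twist model from surj(3) -/

section Tower

variable (V : WeierstrassCurve ℚ) [V.IsElliptic] [V.IsGloballyMinimal] (W : WeierstrassCurve ℚ)

end Tower

/-! ### §2 `E(K_∞)[p^∞] = 0` over `ℤ_p`-extensions of quadratic fields from `Irr` alone -/

/-! ### §3 Line V18 without the (ram) bit -/

section V18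

variable (V : WeierstrassCurve ℚ) [V.IsElliptic] [V.IsGloballyMinimal]
  (W : WeierstrassCurve ℚ) [W.IsElliptic] [W.IsGloballyMinimal]

/-- **Line V18, core inequality, image from `surj(3)` of `W` ALONE (no (ram) bit)**: for `V/ℚ`
globally minimal, good at `3` with `a₃(V) = 0`, `W = C • V^{(−3)}` globally minimal ADDITIVE at `3`
with `ρ̄_{W,3}` onto, both of analytic rank `0`: `#Ш_an(V) = q_V`, `#Ш_an(W) = q_W` with
**`ord₃ #Ш(V) + ord₃ #Ш(W) + 2 ord₃ #V(K) ≤ ord₃ q_V + ord₃ q_W + ord₃ ∏_w c_w(V_K)`**, `K = ℚ(ζ₃)`,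
granted Kobayashi Thm. 4.1 (`hKob`), Kitajima–Otsuki Main Thm. 1.3 (`hKO`), Pollack (`hPol`), Milne
, modularity (`hmod`, `hmodD`), GZK (`hGZK`); NO Milne.  The tower of `V` is §1, `V(K_∞)[3^∞] = 0` is
§2 with `Irr V 3 ⟸ Surj V 3`. [cite: Kobayashi2003, Thm. 4.1 (p. 8)] [cite: KitajimaOtsuki2018, Main Thm. 1.3]
[cite: Milne1972ArithmeticAV, §1 Thm. 1 and §2 (through DokchitserDokchitserAnnals2010, §2.1, proof of Thm. 8)] [cite: Wuthrich2014, Lemma 20 (p. 399)] -/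
theorem XGssCyclotomicThree.exists_padicVal_shaOrder_add_le_of_facts_of_surj_noMilne
    (hKob : Kobayashi2003.thm41_plusCharIdeal_dvd_cyclotomicThree)
    (hKO : KitajimaOtsuki2018.mainThm13_plusSelmerDual_noFiniteSubmodule)
    (hPol : ∀ {N : ℕ} [NeZero N] (f : CuspForm (Gamma0 N) 2),
      pollack_exists_plusMinusPAdicLFunction (W := V) (f := f) (p := 3))
    (hGZK : rank_eq_analyticRank_of_analyticRank_le_one) (hmod : hasEntireLFunction_rat)
    (hmodD : nonempty_modularParametrizationData)
    (C : VariableChange ℚ) (hC : C • V.quadraticTwist (-(3 : ℚ)) = W)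
    (hgood : V.HasGoodReductionAtPrime 3) (ha3 : V.frobeniusTrace 3 = 0)
    (hsurj : Surj W 3) (hadd : Addv W 3) (hrV : V.analyticRank = 0) (hrW : W.analyticRank = 0) :
    ∃ qV qW : ℚ, shaAn V = (qV : ℂ) ∧ shaAn W = (qW : ℂ) ∧
      (padicValNat 3 V.shaOrder : ℤ) + padicValNat 3 W.shaOrder +
          2 * padicValNat 3 (Nat.card (V.baseChange (CyclotomicField 3 ℚ)).toAffine.Point) ≤
        padicValRat 3 qV + padicValRat 3 qW +
          padicValNat 3 (V.baseChange (CyclotomicField 3 ℚ)).tamagawaProduct := by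
  haveI : IsCyclotomicExtension {3} ℚ (CyclotomicField 3 ℚ) := CyclotomicField.isCyclotomicExtension 3 ℚ
  have h2 : Module.finrank ℚ (CyclotomicField 3 ℚ) = 2 :=
    finrank_eq_two_of_isCyclotomicExtension_three (K := CyclotomicField 3 ℚ)
  have hsurjV : Surj V 3 :=
    (surj_iff_of_model_twist V 3 (d := -(3 : ℚ)) (by norm_num) ⟨C, hC⟩).mp hsurj
  have hirrV : Irr V 3 := irr_of_surj V 3 hsurjV
  have htower : ∀ n : ℕ, V.HasSurjectiveModNGaloisRep (3 ^ n : ℕ) :=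
    towerSurj_twist_of_good_of_surj V W C hC hgood hsurj
  -- the newform, the two rational period ratios, Pollack's `L₃⁺(V, X)`
  haveI : NeZero (V.conductorNorm ℤ) := ⟨(V.conductorNorm_pos_holds).ne'⟩
  obtain ⟨Dm⟩ := hmodD V
  have hf : IsNewformOf V Dm.f := Dm.isNewformOf
  obtain ⟨ϖ, -, hϖ, -⟩ := Dm.exists_rat_mul_realPeriodRat_eq_plusPeriod
  obtain ⟨ϖ', -, hϖ'⟩ := exists_rat_mul_imaginaryPeriodRat_eq_minusPeriod Dm
  obtain ⟨L, -, hL⟩ := exists_isSignedPAdicLFunction (hPol Dm.f) (by norm_num) hf hgood ha3 1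
  haveI : (V.baseChange (CyclotomicField 3 ℚ)).IsElliptic := by rw [baseChange]; infer_instance
  refine XGssRankZeroCyclotomicThree.exists_padicVal_shaOrder_add_le_noLocal (CyclotomicField 3 ℚ) V W hGZK
    hmod C hC hgood ha3 hadd hrV hrW hf ϖ ϖ' hϖ hϖ' L hL
    (exists_isCyclotomic_isTopGenerator_cyclotomicThree (CyclotomicField 3 ℚ))
    (fun κ ↦ fixedPoints_kerSubgroup_eq_bot_of_irr V 3 hirrV (CyclotomicField 3 ℚ) h2 κ)
    (fun κ γ hκ hγ hγ' D ↦ ?_) (fun κ γ hκ hγ D _ hX N' hN' ↦ ?_)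
  · obtain ⟨hfin, hX, Lω, hLω, -, hsurj'⟩ := hKob V (CyclotomicField 3 ℚ)
      (V.baseChange (CyclotomicField 3 ℚ)) hgood ha3 ⟨1, one_smul _ _⟩ hκ hγ hγ' hf L hL D ϖ ϖ' hϖ hϖ'
    exact ⟨hfin, hX, Lω, hLω, hsurj' htower⟩
  · exact hKO V 3 (by norm_num) hgood ha3 (CyclotomicField 3 ℚ) (V.baseChange (CyclotomicField 3 ℚ))
      ⟨1, one_smul _ _⟩ κ γ hκ hγ D hX N' hN'

/-- **Line V18, typed UPPER half for the additive curve, no (ram) bit**: in the situation of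
`XGssCyclotomicThree.exists_padicVal_shaOrder_add_le_of_facts_of_surj_noMilne`, if `3 ∤ #Ш_an(V)` and
`3 ∤ ∏_w c_w(V_K)` (`K = ℚ(ζ₃)`) then `Typed.MissingUpperBoundAt W 3`.
[cite: Kobayashi2003, Thm. 4.1 (p. 8)] [cite: KitajimaOtsuki2018, Main Thm. 1.3] [cite: Wuthrich2014, Lemma 20 (p. 399)] -/
theorem XGssCyclotomicThree.missingUpperBoundAt_of_surj_noMilne
    (hKob : Kobayashi2003.thm41_plusCharIdeal_dvd_cyclotomicThree)
    (hKO : KitajimaOtsuki2018.mainThm13_plusSelmerDual_noFiniteSubmodule)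
    (hPol : ∀ {N : ℕ} [NeZero N] (f : CuspForm (Gamma0 N) 2),
      pollack_exists_plusMinusPAdicLFunction (W := V) (f := f) (p := 3))
    (hGZK : rank_eq_analyticRank_of_analyticRank_le_one) (hmod : hasEntireLFunction_rat)
    (hmodD : nonempty_modularParametrizationData)
    (C : VariableChange ℚ) (hC : C • V.quadraticTwist (-(3 : ℚ)) = W)
    (hgood : V.HasGoodReductionAtPrime 3) (ha3 : V.frobeniusTrace 3 = 0)
    (hsurj : Surj W 3) (hadd : Addv W 3) (hrV : V.analyticRank = 0) (hrW : W.analyticRank = 0)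
    {qV : ℚ} (hqV : shaAn V = (qV : ℂ)) (hv : padicValRat 3 qV ≤ 0)
    (htam : padicValNat 3 (V.baseChange (CyclotomicField 3 ℚ)).tamagawaProduct = 0) :
    MissingUpperBoundAt W 3 := by
  obtain ⟨qV', qW, hqV', hqW, hle⟩ :=
    XGssCyclotomicThree.exists_padicVal_shaOrder_add_le_of_facts_of_surj_noMilne V W hKob hKO hPol hGZK
      hmod hmodD C hC hgood ha3 hsurj hadd hrV hrW
  have hqq : qV' = qV := by exact_mod_cast hqV'.symm.trans hqV
  subst hqq
  refine ⟨qW, hqW, ?_⟩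
  have h0 : (0 : ℤ) ≤ padicValNat 3 V.shaOrder := by positivity
  have h1 : (0 : ℤ) ≤ padicValNat 3 (Nat.card (V.baseChange (CyclotomicField 3 ℚ)).toAffine.Point) := by
    positivity
  rw [htam, Nat.cast_zero, add_zero] at hle
  linarith

/-- **Line V18, `BSD(W,3) ∧ BSD(V,3)` on the doubly-unit rank-`(0,0)` rows, no (ram) bit**: in the
situation of `XGssCyclotomicThree.exists_padicVal_shaOrder_add_le_of_facts_of_surj_noMilne`, if `#Ш_an(V)`,
`#Ш_an(W)` are `3`-adic units and `3 ∤ ∏_w c_w(V_K)` then Miller's `BSD(W,3)` (the ADDITIVE,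
potentially supersingular X4 pair) and `BSD(V,3)` (its good supersingular twist, `a₃(V) = 0`) hold.
Inputs: the named facts of line V18, modularity, GZK, and the census bits `surj(3)`, `3 ∤ #Ш_an` of
the two curves and `3 ∤ ∏_w c_w(V_K)`.  Label X4 UNCHANGED; nothing booked by this theorem.
[cite: Kobayashi2003, Thm. 4.1 (p. 8)] [cite: KitajimaOtsuki2018, Main Thm. 1.3]
[cite: Milne1972ArithmeticAV, §1 Thm. 1 and §2 (through DokchitserDokchitserAnnals2010, §2.1, proof of Thm. 8)] [cite: Miller2011LMS, §1 and Def. 1.1] [cite: Wuthrich2014, Lemma 20 (p. 399)] -/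
theorem XGssCyclotomicThree.bsdp_of_shaAn_units_of_surj_noMilne
    (hKob : Kobayashi2003.thm41_plusCharIdeal_dvd_cyclotomicThree)
    (hKO : KitajimaOtsuki2018.mainThm13_plusSelmerDual_noFiniteSubmodule)
    (hPol : ∀ {N : ℕ} [NeZero N] (f : CuspForm (Gamma0 N) 2),
      pollack_exists_plusMinusPAdicLFunction (W := V) (f := f) (p := 3))
    (hGZK : rank_eq_analyticRank_of_analyticRank_le_one) (hmod : hasEntireLFunction_rat)
    (hmodD : nonempty_modularParametrizationData)
    (C : VariableChange ℚ) (hC : C • V.quadraticTwist (-(3 : ℚ)) = W)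
    (hgood : V.HasGoodReductionAtPrime 3) (ha3 : V.frobeniusTrace 3 = 0)
    (hsurj : Surj W 3) (hadd : Addv W 3) (hrV : V.analyticRank = 0) (hrW : W.analyticRank = 0)
    {qV qW : ℚ} (hqV : shaAn V = (qV : ℂ)) (hqW : shaAn W = (qW : ℂ))
    (hvV : padicValRat 3 qV = 0) (hvW : padicValRat 3 qW = 0)
    (htam : padicValNat 3 (V.baseChange (CyclotomicField 3 ℚ)).tamagawaProduct = 0) :
    BSDp W 3 ∧ BSDp V 3 := by
  obtain ⟨qV', qW', hqV', hqW', hle⟩ :=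
    XGssCyclotomicThree.exists_padicVal_shaOrder_add_le_of_facts_of_surj_noMilne V W hKob hKO hPol hGZK
      hmod hmodD C hC hgood ha3 hsurj hadd hrV hrW
  have hqq : qV' = qV := by exact_mod_cast hqV'.symm.trans hqV
  have hqq' : qW' = qW := by exact_mod_cast hqW'.symm.trans hqW
  subst hqq hqq'
  rw [hvV, hvW, htam, Nat.cast_zero, add_zero, add_zero] at hle
  have hV0 : (0 : ℤ) ≤ padicValNat 3 V.shaOrder := by positivity
  have hW0 : (0 : ℤ) ≤ padicValNat 3 W.shaOrder := by positivity
  have hK0 : (0 : ℤ) ≤ padicValNat 3 (Nat.card (V.baseChange (CyclotomicField 3 ℚ)).toAffine.Point) := by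
    positivity
  have huW : MissingUpperBoundAt W 3 := ⟨qW', hqW', by rw [hvW]; linarith⟩
  have huV : MissingUpperBoundAt V 3 := ⟨qV', hqV', by rw [hvV]; linarith⟩
  exact ⟨bsdp_of_missingPPartAt W 3 hGZK (by rw [hrW]; exact zero_le_one)
      (missingPPartAt_of_upper_of_shaAn_unit W 3 huW hqW' hvW),
    bsdp_of_missingPPartAt V 3 hGZK (by rw [hrV]; exact zero_le_one)
      (missingPPartAt_of_upper_of_shaAn_unit V 3 huV hqV' hvV)⟩

/-- **X4 at `p = 3`, CLASS level, supersingular twist, ranks `(0,0)`, no (ram) bit: the sum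
inequality** — additive-p4's `ClassX4.exists_padicVal_shaOrder_add_le_three_of_ssTwist_noMilne` with the census
bit `ram(3)` deleted. [cite: Kobayashi2003, Thm. 4.1 (p. 8)] [cite: KitajimaOtsuki2018, Main Thm. 1.3]
[cite: Wuthrich2014, Lemma 20 (p. 399)] -/
theorem ClassX4.exists_padicVal_shaOrder_add_le_three_of_ssTwist_noRam_noMilne
    (hKob : Kobayashi2003.thm41_plusCharIdeal_dvd_cyclotomicThree)
    (hKO : KitajimaOtsuki2018.mainThm13_plusSelmerDual_noFiniteSubmodule)
    (hPol : ∀ {N : ℕ} [NeZero N] (f : CuspForm (Gamma0 N) 2),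
      pollack_exists_plusMinusPAdicLFunction (W := V) (f := f) (p := 3))
    (hGZK : rank_eq_analyticRank_of_analyticRank_le_one) (hmod : hasEntireLFunction_rat)
    (hmodD : nonempty_modularParametrizationData)
    (hX : ClassX4 W 3) (hsurj : Surj W 3)
    (C : VariableChange ℚ) (hC : C • V.quadraticTwist (-(3 : ℚ)) = W)
    (hgood : V.HasGoodReductionAtPrime 3) (ha3 : V.frobeniusTrace 3 = 0)
    (hrV : V.analyticRank = 0) (hrW : W.analyticRank = 0) :
    ∃ qV qW : ℚ, shaAn V = (qV : ℂ) ∧ shaAn W = (qW : ℂ) ∧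
      (padicValNat 3 V.shaOrder : ℤ) + padicValNat 3 W.shaOrder +
          2 * padicValNat 3 (Nat.card (V.baseChange (CyclotomicField 3 ℚ)).toAffine.Point) ≤
        padicValRat 3 qV + padicValRat 3 qW +
          padicValNat 3 (V.baseChange (CyclotomicField 3 ℚ)).tamagawaProduct :=
  XGssCyclotomicThree.exists_padicVal_shaOrder_add_le_of_facts_of_surj_noMilne V W hKob hKO hPol hGZK
    hmod hmodD C hC hgood ha3 hsurj hX.2.1 hrV hrW

/-- **X4 at `p = 3`, class level, supersingular twist, no (ram) bit: the cell's typed UPPER half for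
the additive curve** (`3 ∤ #Ш_an(V)`, `3 ∤ ∏_w c_w(V_K)`). [cite: Kobayashi2003, Thm. 4.1 (p. 8)]
[cite: KitajimaOtsuki2018, Main Thm. 1.3] [cite: Wuthrich2014, Lemma 20 (p. 399)] -/
theorem ClassX4.missingUpperBoundAt_three_of_ssTwist_noRam_noMilne
    (hKob : Kobayashi2003.thm41_plusCharIdeal_dvd_cyclotomicThree)
    (hKO : KitajimaOtsuki2018.mainThm13_plusSelmerDual_noFiniteSubmodule)
    (hPol : ∀ {N : ℕ} [NeZero N] (f : CuspForm (Gamma0 N) 2),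
      pollack_exists_plusMinusPAdicLFunction (W := V) (f := f) (p := 3))
    (hGZK : rank_eq_analyticRank_of_analyticRank_le_one) (hmod : hasEntireLFunction_rat)
    (hmodD : nonempty_modularParametrizationData)
    (hX : ClassX4 W 3) (hsurj : Surj W 3)
    (C : VariableChange ℚ) (hC : C • V.quadraticTwist (-(3 : ℚ)) = W)
    (hgood : V.HasGoodReductionAtPrime 3) (ha3 : V.frobeniusTrace 3 = 0)
    (hrV : V.analyticRank = 0) (hrW : W.analyticRank = 0)
    {qV : ℚ} (hqV : shaAn V = (qV : ℂ)) (hv : padicValRat 3 qV ≤ 0)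
    (htam : padicValNat 3 (V.baseChange (CyclotomicField 3 ℚ)).tamagawaProduct = 0) :
    MissingUpperBoundAt W 3 :=
  XGssCyclotomicThree.missingUpperBoundAt_of_surj_noMilne V W hKob hKO hPol hGZK hmod hmodD C hC hgood
    ha3 hsurj hX.2.1 hrV hrW hqV hv htam

/-- **X4 at `p = 3`, class level, supersingular twist, no (ram) bit: `BSD(W,3) ∧ BSD(V,3)` on the
doubly-unit rank-`(0,0)` rows** — additive-p4's `ClassX4.bsdp_three_of_ssTwist_of_shaAn_units_noMilne` with the
census bit `ram(3)` deleted; labels UNCHANGED; nothing booked by this theorem.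
[cite: Kobayashi2003, Thm. 4.1 (p. 8)] [cite: KitajimaOtsuki2018, Main Thm. 1.3]
[cite: Milne1972ArithmeticAV, §1 Thm. 1 and §2 (through DokchitserDokchitserAnnals2010, §2.1, proof of Thm. 8)] [cite: Miller2011LMS, §1 and Def. 1.1] [cite: Wuthrich2014, Lemma 20 (p. 399)] -/
theorem ClassX4.bsdp_three_of_ssTwist_of_shaAn_units_noRam_noMilne
    (hKob : Kobayashi2003.thm41_plusCharIdeal_dvd_cyclotomicThree)
    (hKO : KitajimaOtsuki2018.mainThm13_plusSelmerDual_noFiniteSubmodule)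
    (hPol : ∀ {N : ℕ} [NeZero N] (f : CuspForm (Gamma0 N) 2),
      pollack_exists_plusMinusPAdicLFunction (W := V) (f := f) (p := 3))
    (hGZK : rank_eq_analyticRank_of_analyticRank_le_one) (hmod : hasEntireLFunction_rat)
    (hmodD : nonempty_modularParametrizationData)
    (hX : ClassX4 W 3) (hsurj : Surj W 3)
    (C : VariableChange ℚ) (hC : C • V.quadraticTwist (-(3 : ℚ)) = W)
    (hgood : V.HasGoodReductionAtPrime 3) (ha3 : V.frobeniusTrace 3 = 0)
    (hrV : V.analyticRank = 0) (hrW : W.analyticRank = 0)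
    {qV qW : ℚ} (hqV : shaAn V = (qV : ℂ)) (hqW : shaAn W = (qW : ℂ))
    (hvV : padicValRat 3 qV = 0) (hvW : padicValRat 3 qW = 0)
    (htam : padicValNat 3 (V.baseChange (CyclotomicField 3 ℚ)).tamagawaProduct = 0) :
    BSDp W 3 ∧ BSDp V 3 :=
  XGssCyclotomicThree.bsdp_of_shaAn_units_of_surj_noMilne V W hKob hKO hPol hGZK hmod hmodD C hC hgood
    ha3 hsurj hX.2.1 hrV hrW hqV hqW hvV hvW htam

end V18

end Summit.BirchSwinnertonDyer.Rank1Residual.Additive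

end
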